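import Literature.NumberTheory.EllipticCurves.IwasawaAlgebraEisensteinCoefficientRingProofs
import Literature.NumberTheory.EllipticCurves.IwasawaAlgebraEisensteinQuotientTorsionProofs
import Literature.NumberTheory.EllipticCurves.ZpExtensionScalarTwistMaps
import HarnessLib

/-!
# The value tower `A_{m,k} = S_m/p^k` has torsion-free limit: `p • q = 0 ⇒ reduce q = 0`
# (theorems only; no definition, no named fact, no instance, no `sorry`)

Topic `NumberTheory/EllipticCurves` (companion of `IwasawaAlgebraEisensteinCoefficientRingProofs`,
`ZpExtensionScalarTwistMaps`).  The abstract H.4 descent of the cell `pub/bsd-print-x9`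
(`TowerSaturatedAnnihilatorProofs`, hypothesis `hQ` of `Tower.pairing_eq_zero_of_mem_levelCondition` /
`Tower.levelCondition_mem_iff_forall_pairing_eq_zero`) asks of the VALUE tower `(Q_j, redQ)` of the level
pairings that its limit have no `p`-torsion, in the levelwise form «`p • q = 0 → redQ q = 0`».  For Howard's
`R_k(1)`-valued pairings on the Eisenstein levels the value groups are the coefficient rings
`A_{m,k} = Λ/(T^m + p, p^k) = S_m/p^k S_m` (`S_m = Λ/(T^m + p)` a DVR in which `p ≠ 0`) with the reductions
`EisensteinCoeff.reduce`; this file proves the clause for them: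

* `EisensteinCoeff.reduce_ofSpec` — `reduce ∘ ofSpec_{k′} = ofSpec_k` (`S_m ↠ A_{m,k′} ↠ A_{m,k}`);
* `EisensteinCoeff.exists_eq_mul_pow_of_natCast_mul_eq_zero` — `p q = 0` in `A_{m,k+1}` forces `q ∈ p^k A_{m,k+1}`;
* **`EisensteinCoeff.reduce_eq_zero_of_natCast_mul_eq_zero`** / **`…_of_nsmul_eq_zero`** — `p • q = 0` in
  `A_{m,k′}`, `k < k′` ⇒ `reduce q = 0` in `A_{m,k}`.

References: B. Howard, Compositio Math. 140 (2004), §2.2 and proof of Thm. 2.2.10 (arXiv:1202.6340: `𝔮 = T^m + p`,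
`T_𝔮/p^k`); L. Washington, *Introduction to Cyclotomic Fields* (1997), §13.2.  BSD is not proved by any of this.
-/

noncomputable section

namespace Literature.NumberTheory.EllipticCurves

namespace IwasawaAlgebra

variable {p : ℕ} [hp : Fact p.Prime]

namespace EisensteinCoeff

/-- `reduce ∘ ofSpec = ofSpec`: reducing `S_m ↠ A_{m,k′}` further to `A_{m,k}` is the reduction `S_m ↠ A_{m,k}`.
[cite: Howard2004HeegnerKolyvagin, §2.2 (A_{m,k} = S_𝔮/p^k S_𝔮)] -/
theorem reduce_ofSpec (m : ℕ) {k k' : ℕ} (hkk' : k ≤ k')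
    (s : IwasawaAlgebra p ⧸ Ideal.span {(PowerSeries.X ^ m + PowerSeries.C (p : ℤ_[p]) : IwasawaAlgebra p)}) :
    reduce p m hkk' (ofSpec p m k' s) = ofSpec p m k s := by
  obtain ⟨x, rfl⟩ := Ideal.Quotient.mk_surjective s
  rw [ofSpec_mk, reduce_mk, ofSpec_mk]

/-- **`p q = 0` in `A_{m,k+1}` forces `q ∈ p^k A_{m,k+1}`** (`A_{m,k+1} = S_m/p^{k+1}` with `S_m` a domain in
which `p ≠ 0`: `p s ∈ p^{k+1} S_m ⇒ s ∈ p^k S_m`). [cite: Howard2004HeegnerKolyvagin, §2.2 and proof of Thm. 2.2.10]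
[cite: Washington1997, §13.2] -/
theorem exists_eq_mul_pow_of_natCast_mul_eq_zero {m : ℕ} (hm : 1 ≤ m) (k : ℕ) (q : EisensteinCoeff p m (k + 1))
    (hq : (p : EisensteinCoeff p m (k + 1)) * q = 0) :
    ∃ c : EisensteinCoeff p m (k + 1), q = c * (p : EisensteinCoeff p m (k + 1)) ^ k := by
  haveI := isDomain_quotient_X_pow_add_C p hm
  obtain ⟨s, rfl⟩ := ofSpec_surjective m (k + 1) q
  have hnat : ofSpec p m (k + 1) (p : _) = (p : EisensteinCoeff p m (k + 1)) :=
    map_natCast (ofSpec p m (k + 1)) p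
  have h1 : ofSpec p m (k + 1) ((p : _) * s) = 0 := by
    rw [map_mul, hnat]
    exact hq
  obtain ⟨c, hc⟩ := (ofSpec_eq_zero_iff m (k + 1) _).1 h1
  have hp0 : ((p : IwasawaAlgebra p ⧸
      Ideal.span {(PowerSeries.X ^ m + PowerSeries.C (p : ℤ_[p]) : IwasawaAlgebra p)})) ≠ 0 :=
    natCast_ne_zero p hm hp.out.ne_zero
  have hs : s = c * (p : _) ^ k :=
    mul_left_cancel₀ hp0 (by rw [hc, pow_succ]; ring)
  have hpow := (ofSpec p m (k + 1)).map_pow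
    (p : IwasawaAlgebra p ⧸ Ideal.span {(PowerSeries.X ^ m + PowerSeries.C (p : ℤ_[p]) : IwasawaAlgebra p)}) k
  exact ⟨ofSpec p m (k + 1) c, by rw [hs, map_mul, hpow, hnat]⟩

/-- **`p q = 0` in `A_{m,k′}` with `k < k′` ⇒ `reduce q = 0` in `A_{m,k}`**: the levelwise clause
«`p • q = 0 → redQ q = 0`» (torsion-free limit `lim_k A_{m,k} = S_m`) of the abstract H.4 descent, for the value
tower of the Eisenstein coefficient rings. [cite: Howard2004HeegnerKolyvagin, §2.2 and proof of Thm. 2.2.10] [cite: Washington1997, §13.2] -/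
theorem reduce_eq_zero_of_natCast_mul_eq_zero {m : ℕ} (hm : 1 ≤ m) {k k' : ℕ} (hk : k < k')
    (q : EisensteinCoeff p m k') (hq : (p : EisensteinCoeff p m k') * q = 0) :
    reduce p m hk.le q = 0 := by
  obtain ⟨k'', rfl⟩ : ∃ k'', k' = k'' + 1 := ⟨k' - 1, by omega⟩
  obtain ⟨c, rfl⟩ := exists_eq_mul_pow_of_natCast_mul_eq_zero hm k'' q hq
  obtain ⟨s, rfl⟩ := ofSpec_surjective m (k'' + 1) c
  have hnat : (p : EisensteinCoeff p m (k'' + 1)) = ofSpec p m (k'' + 1) (p : _) :=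
    (map_natCast (ofSpec p m (k'' + 1)) p).symm
  rw [hnat, ← map_pow, ← map_mul, reduce_ofSpec, ofSpec_eq_zero_iff]
  exact ⟨s * (p : _) ^ (k'' - k), by rw [mul_assoc, ← pow_add, Nat.sub_add_cancel (by omega)]⟩

/-- The same with the natural-number scalar action: `p • q = 0` in `A_{m,k′}`, `k < k′` ⇒ `reduce q = 0` — the
form `hQ : ∀ j q, p • q = 0 → redQ j q = 0` of `Tower.pairing_eq_zero_of_mem_levelCondition` for
`Q_j = A_{m,j+1}`, `redQ j = reduce`. [cite: Howard2004HeegnerKolyvagin, §2.2] -/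
theorem reduce_eq_zero_of_nsmul_eq_zero {m : ℕ} (hm : 1 ≤ m) {k k' : ℕ} (hk : k < k')
    (q : EisensteinCoeff p m k') (hq : p • q = 0) : reduce p m hk.le q = 0 :=
  reduce_eq_zero_of_natCast_mul_eq_zero hm hk q (by rwa [← nsmul_eq_mul])

/-- Module form: in any `A_{m,k′}`-module in which `A_{m,k′}` acts faithfully enough — here the ring itself
viewed along `reduce` — stated for the successor step of the tower `j ↦ A_{m,j+1}` used by D1
(`EisensteinCoeff p m (j + 2) → EisensteinCoeff p m (j + 1)`). [cite: Howard2004HeegnerKolyvagin, §2.2] -/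
theorem reduce_succ_eq_zero_of_nsmul_eq_zero {m : ℕ} (hm : 1 ≤ m) (j : ℕ) (q : EisensteinCoeff p m (j + 2))
    (hq : p • q = 0) : reduce p m (Nat.le_succ (j + 1)) q = 0 :=
  reduce_eq_zero_of_nsmul_eq_zero hm (Nat.lt_succ_self (j + 1)) q hq

end EisensteinCoeff

end IwasawaAlgebra

end Literature.NumberTheory.EllipticCurves

end
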